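import Mathlib.Data.Real.Basic
import Mathlib.Tactic.Linarith
import Mathlib.Tactic.Ring
import Mathlib.Tactic.Positivity
import HarnessLib
import HarnessLib.Audit

/-!
# `NoHeavyLowerTail` (crux stmt-CriticalPhenomena-4575), Sahi programme P4: the algebraic core of the PAIR inequality for the
# OR of TWO disjoint principal filters (`(x₁∧…∧x_a) ∨ (y₁∧…∧y_b)`, "DNF₂")

Support file (cell `prim-l12`, seat P4, generation 12; `--supports stmt-CriticalPhenomena-4575`).  No named facts, no sorries;
standard axioms; def-free; pure real algebra (the combinatorial wrapper is the successor's task, blueprint in HOME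
prim-l12-p4/FROM-prim-l12-p4-gen12-CERTIFICATE-OBSTRUCTION.md §5).

SETTING.  Two disjoint blocks of variables with `p₁ = P(block 1 complete)`, `p₂ = P(block 2 complete)` (any block sizes, any product
measure), `qᵢ = 1 − pᵢ`, `d = q₁q₂`, `u = 1 − d`, `Δ = p₁q₂ + q₁p₂` (exactly one block complete).  The slot `U = T₁ ∨ T₂` carries the
EXPLICIT flow certificate `r = (1+d)·ν·1_U − (ud/Δ)·ν·1_{exactly one complete}` (each receiver — no block complete — completes block `i`
with probability `∝ pᵢ ∏_{j≠i} qⱼ`; loads are constant on "exactly one complete"; cap: `(1+d)Δ ≥ ud`).  Its PAIR condition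
(`…SahiE3PatternCertificate`) for up-sets `S, T` is, with `f_χ = ν(S | completion pattern χ)`, `g_χ`, `h_χ` (for `S ∩ T`), `χ ∈ {11,10,01,00}`,
`f₁₁ = g₁₁ = h₁₁ = 1`:   `T := E[h·κ] − (1+d)·E f·E g + d·(f₀₀·E g + g₀₀·E f) ≥ 0`, `κ(11) = 1+d`, `κ(10) = κ(01) = (1+d) − ud/Δ`, `κ(00) = 0`.

THEOREM `dnf_two_pair_core`: `Δ·T` equals `(Δ−d p₁p₂)·(p₁Φ₁ + p₂Φ₂)` plus an explicit nonnegative combination of products of the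
section gaps, where `Φ₁ = (p₂ + q₂h₁₀) − (p₂ + q₂f₁₀)(p₂ + q₂g₁₀) ≥ 0` is Harris' inequality in the face {block 1 complete} and `Φ₂`
likewise.  Hence `Δ·T ≥ 0` from `0 ≤ pᵢ ≤ 1`, monotone sections in `[0,1]`, and the two face-Harris inequalities.  (Found by LP over
the section abstraction, HOME code/gen12/sos2.py; verified symbolically, verify_m2.py / verify_chain.py; `h₀₀` does not occur.)
With the certificate bookkeeping this yields Sahi's `C₃` / Kahn's Conjecture 5 for the first slot `(x₁∧…∧x_a) ∨ (y₁∧…∧y_b)` under every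
product measure in every dimension — the first slot class beyond linear read-once formulas (generation 11) on the OR side.
-/

namespace Summit.CriticalPhenomena.PercolationContinuityZ3.Theorems.SahiE3DnfPairAlgebra

/-- **PAIR inequality for the OR of two disjoint principal blocks, algebraic core.**  For `0 ≤ p₁, p₂ ≤ 1`, section values
`0 ≤ f₀₀ ≤ f₁₀, f₀₁ ≤ 1`, `0 ≤ g₀₀ ≤ g₁₀, g₀₁ ≤ 1`, arbitrary `h₁₀, h₀₁` satisfying the two face-Harris inequalities
`(p₂ + q₂f₁₀)(p₂ + q₂g₁₀) ≤ p₂ + q₂h₁₀` and `(p₁ + q₁f₀₁)(p₁ + q₁g₀₁) ≤ p₁ + q₁h₀₁` (`qᵢ = 1 − pᵢ`), the quantity `Δ·T` of the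
module docstring is nonnegative.  Proof: the explicit sum-of-products identity
`Δ·T = K(p₁Φ₁ + p₂Φ₂) + d p₁²p₂q₂[X(1−Y′)+X′(1−Y)] + d p₁p₂²q₁[Y(1−X′)+Y′(1−X)] + d²p₁²p₂²[XX′+YY′] + d²p₁q₁p₂²[X(Z′−Y′)+(Z−Y)X′]
 + d²p₂(p₁q₂+q₁²p₂)(Z−Y)(Z′−Y′) + d²p₁(q₂Δ+q₁p₂²)(Z−X)(Z′−X′) + d²p₁²p₂q₂[Y(Z′−X′)+(Z−X)Y′]`,
`K = Δ − d p₁p₂ ≥ 0`, `X = 1−f₁₀, Y = 1−f₀₁, Z = 1−f₀₀` (primes for `g`), closed by `linarith`. [this work] -/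
theorem dnf_two_pair_core (p₁ p₂ f₁₀ f₀₁ f₀₀ g₁₀ g₀₁ g₀₀ h₁₀ h₀₁ : ℝ)
    (hp₁ : 0 ≤ p₁) (hp₁' : p₁ ≤ 1) (hp₂ : 0 ≤ p₂) (hp₂' : p₂ ≤ 1)
    (hf₀ : 0 ≤ f₀₀) (hf₁ : f₀₀ ≤ f₁₀) (hf₂ : f₀₀ ≤ f₀₁) (hf₃ : f₁₀ ≤ 1) (hf₄ : f₀₁ ≤ 1)
    (hg₀ : 0 ≤ g₀₀) (hg₁ : g₀₀ ≤ g₁₀) (hg₂ : g₀₀ ≤ g₀₁) (hg₃ : g₁₀ ≤ 1) (hg₄ : g₀₁ ≤ 1)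
    (H₁ : (p₂ + (1 - p₂) * f₁₀) * (p₂ + (1 - p₂) * g₁₀) ≤ p₂ + (1 - p₂) * h₁₀)
    (H₂ : (p₁ + (1 - p₁) * f₀₁) * (p₁ + (1 - p₁) * g₀₁) ≤ p₁ + (1 - p₁) * h₀₁) :
    0 ≤ ((1 + (1 - p₁) * (1 - p₂)) * (p₁ * (1 - p₂) + (1 - p₁) * p₂)
            - (1 - (1 - p₁) * (1 - p₂)) * ((1 - p₁) * (1 - p₂)))
          * (p₁ * (1 - p₂) * h₁₀ + (1 - p₁) * p₂ * h₀₁)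
        + (p₁ * (1 - p₂) + (1 - p₁) * p₂) * (1 + (1 - p₁) * (1 - p₂)) * (p₁ * p₂)
        - (p₁ * (1 - p₂) + (1 - p₁) * p₂) * (1 + (1 - p₁) * (1 - p₂))
          * ((p₁ * p₂ + p₁ * (1 - p₂) * f₁₀ + (1 - p₁) * p₂ * f₀₁ + (1 - p₁) * (1 - p₂) * f₀₀)
            * (p₁ * p₂ + p₁ * (1 - p₂) * g₁₀ + (1 - p₁) * p₂ * g₀₁ + (1 - p₁) * (1 - p₂) * g₀₀))
        + (p₁ * (1 - p₂) + (1 - p₁) * p₂) * ((1 - p₁) * (1 - p₂))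
          * (f₀₀ * (p₁ * p₂ + p₁ * (1 - p₂) * g₁₀ + (1 - p₁) * p₂ * g₀₁ + (1 - p₁) * (1 - p₂) * g₀₀)
            + g₀₀ * (p₁ * p₂ + p₁ * (1 - p₂) * f₁₀ + (1 - p₁) * p₂ * f₀₁ + (1 - p₁) * (1 - p₂) * f₀₀)) := by
  -- shorthand for the nonnegative building blocks
  have hq₁ : 0 ≤ 1 - p₁ := by linarith
  have hq₂ : 0 ≤ 1 - p₂ := by linarith
  have hd : 0 ≤ (1 - p₁) * (1 - p₂) := mul_nonneg hq₁ hq₂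
  have hΔ : 0 ≤ p₁ * (1 - p₂) + (1 - p₁) * p₂ := by positivity
  have hK : 0 ≤ (p₁ * (1 - p₂) + (1 - p₁) * p₂) - (1 - p₁) * (1 - p₂) * (p₁ * p₂) := by
    nlinarith [mul_nonneg (mul_nonneg hp₁ hq₂) (mul_nonneg hq₁ hp₂), mul_nonneg hq₁ hp₂, mul_nonneg hp₁ hq₂,
      mul_nonneg (mul_nonneg hp₁ hq₂) hp₂]
  have hΦ₁ : 0 ≤ p₂ + (1 - p₂) * h₁₀ - (p₂ + (1 - p₂) * f₁₀) * (p₂ + (1 - p₂) * g₁₀) := by linarith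
  have hΦ₂ : 0 ≤ p₁ + (1 - p₁) * h₀₁ - (p₁ + (1 - p₁) * f₀₁) * (p₁ + (1 - p₁) * g₀₁) := by linarith
  have hX : 0 ≤ 1 - f₁₀ := by linarith
  have hY : 0 ≤ 1 - f₀₁ := by linarith
  have hX' : 0 ≤ 1 - g₁₀ := by linarith
  have hY' : 0 ≤ 1 - g₀₁ := by linarith
  have hZX : 0 ≤ f₁₀ - f₀₀ := by linarith
  have hZY : 0 ≤ f₀₁ - f₀₀ := by linarith
  have hZX' : 0 ≤ g₁₀ - g₀₀ := by linarith
  have hZY' : 0 ≤ g₀₁ - g₀₀ := by linarith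
  have hf₁₀ : 0 ≤ f₁₀ := by linarith
  have hf₀₁ : 0 ≤ f₀₁ := by linarith
  have hg₁₀ : 0 ≤ g₁₀ := by linarith
  have hg₀₁ : 0 ≤ g₀₁ := by linarith
  -- the sum-of-products certificate
  have P0 : 0 ≤ ((p₁ * (1 - p₂) + (1 - p₁) * p₂) - (1 - p₁) * (1 - p₂) * (p₁ * p₂))
      * (p₁ * (p₂ + (1 - p₂) * h₁₀ - (p₂ + (1 - p₂) * f₁₀) * (p₂ + (1 - p₂) * g₁₀))
        + p₂ * (p₁ + (1 - p₁) * h₀₁ - (p₁ + (1 - p₁) * f₀₁) * (p₁ + (1 - p₁) * g₀₁))) :=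
    mul_nonneg hK (add_nonneg (mul_nonneg hp₁ hΦ₁) (mul_nonneg hp₂ hΦ₂))
  have P1 : 0 ≤ (1 - p₁) * (1 - p₂) * (p₁ * p₁) * p₂ * (1 - p₂)
      * ((1 - f₁₀) * g₀₁ + (1 - g₁₀) * f₀₁) := by
    have := add_nonneg (mul_nonneg hX hg₀₁) (mul_nonneg hX' hf₀₁); positivity
  have P2 : 0 ≤ (1 - p₁) * (1 - p₂) * p₁ * (p₂ * p₂) * (1 - p₁)
      * ((1 - f₀₁) * g₁₀ + (1 - g₀₁) * f₁₀) := by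
    have := add_nonneg (mul_nonneg hY hg₁₀) (mul_nonneg hY' hf₁₀); positivity
  have P3 : 0 ≤ ((1 - p₁) * (1 - p₂)) ^ 2 * (p₁ * p₁) * (p₂ * p₂)
      * ((1 - f₀₁) * (1 - g₀₁) + (1 - f₁₀) * (1 - g₁₀)) := by
    have := add_nonneg (mul_nonneg hY hY') (mul_nonneg hX hX'); positivity
  have P4 : 0 ≤ ((1 - p₁) * (1 - p₂)) ^ 2 * p₁ * (1 - p₁) * (p₂ * p₂)
      * ((1 - f₁₀) * (g₀₁ - g₀₀) + (f₀₁ - f₀₀) * (1 - g₁₀)) := by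
    have := add_nonneg (mul_nonneg hX hZY') (mul_nonneg hZY hX'); positivity
  have P5 : 0 ≤ ((1 - p₁) * (1 - p₂)) ^ 2 * p₂ * (p₁ * (1 - p₂) + (1 - p₁) * (1 - p₁) * p₂)
      * ((f₀₁ - f₀₀) * (g₀₁ - g₀₀)) := by
    have := mul_nonneg hZY hZY'; positivity
  have P6 : 0 ≤ ((1 - p₁) * (1 - p₂)) ^ 2 * p₁
      * ((1 - p₂) * (p₁ * (1 - p₂) + (1 - p₁) * p₂) + (1 - p₁) * (p₂ * p₂))
      * ((f₁₀ - f₀₀) * (g₁₀ - g₀₀)) := by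
    have := mul_nonneg hZX hZX'; positivity
  have P7 : 0 ≤ ((1 - p₁) * (1 - p₂)) ^ 2 * (p₁ * p₁) * p₂ * (1 - p₂)
      * ((1 - f₀₁) * (g₁₀ - g₀₀) + (f₁₀ - f₀₀) * (1 - g₀₁)) := by
    have := add_nonneg (mul_nonneg hY hZX') (mul_nonneg hZX hY'); positivity
  linarith [P0, P1, P2, P3, P4, P5, P6, P7]

end Summit.CriticalPhenomena.PercolationContinuityZ3.Theorems.SahiE3DnfPairAlgebra
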